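import Literature.Probability.LatticeModels.MedialInterfaceProofs
import Literature.Probability.Percolation.BoxCrossingProofs
import Summits.CriticalPhenomena.CardyFormulaZ2.Theorems.CardySelfRefinementLagHandOffKernelWalkToContact
import HarnessLib

/-!
# The contact identity for the open cluster of the wired arc: stub
`stub_kernel_contactIdentity` (K5) of line `hitting-tournament` for crux `LagHandOff`
(stmt-CriticalPhenomena-10268)

The IDENTITY brick of the contact kernel of seat c5.  Let `E` be ADMISSIBLE discrete Dobrushin
data (`DiscreteDobrushin.IsZdAdmissible`,
`Literature/Probability/LatticeModels/MedialInterface.lean`), `ω` a bond configuration of `ℤ²`,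
and `E.bcBondConfig ω` the configuration with the Dobrushin boundary condition imposed (the arc
of `A` wired, the edges at the arc of `B` closed).  For a site `x` of `Ω_δ = meshDomain E.Ω E.δ`
off the two discrete arcs `E.zdArcA ∪ E.zdArcB`:

  `x` lies in the `E.bcBondConfig ω`-open cluster of (a site of) the discrete arc of `A`
  iff
  `x` is joined inside `Ω_δ ∖ arcs`, by `ω`-open edges of the graph `Ω_δ`, to a non-arc site
  `u` carrying an `ω`-OPEN contact edge `{u, u'}` of `Ω_δ` into the discrete arc of `A`.

Proof.

* (⇒) `contact_of_walk`: induction along an open walk of `E.bcBondConfig ω` from a non-arc site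
  `a ∈ Ω_δ` to an arc-`A` site.  The first edge `{a, b}` is open in the completed configuration
  and `a ∉ zdArcA`, so the wiring alternative fails: `{a, b}` is an `ω`-open `Ω_δ`-edge with no
  endpoint on the arc of `B` (`mem_of_adj_bcBondConfig`), and `b ∈ Ω_δ`.  If `b ∈ zdArcA` the
  contact edge is `{a, b}` itself; otherwise `b` is off both arcs, the induction hypothesis gives
  a contact from `b`, and the open `Ω_δ`-edge `{a, b}` is prepended
  (`KernelWalkToContact.mem_openConnIn_of_adj_of_subset`).
* (⇐) `reachable_of_contact`: every edge of the induced open graph of `ω ∩ E(Ω_δ)` on the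
  non-arc sites is open in `E.bcBondConfig ω` (second alternative: `ω`-open, no endpoint on the
  arc of `B`), which gives a graph homomorphism into `openGraph (E.bcBondConfig ω)` transporting
  reachability (`SimpleGraph.Reachable.map`); the contact edge `{u, u'}` is open in
  `E.bcBondConfig ω` too (`u` is off the arcs, `u' ∈ zdArcA` is off `zdArcB` by
  `IsZdAdmissible.disjoint`).

Only definitions and lemmas of `DomainDiscretisation.lean`, `MedialInterface.lean`,
`Percolation.lean`, the landed sibling `…LagHandOffKernelWalkToContact.lean` and Mathlib's
`SimpleGraph.Walk` / `SimpleGraph.Reachable` / `SimpleGraph.induce` API are used.  Helpers live in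
the sub-namespace `KernelContactIdentity`.
-/

noncomputable section

open Set Metric
open Literature.Probability.Percolation Literature.Probability.LatticeModels
open Literature.Probability.RandomPlanarGeometry

namespace Summit.CriticalPhenomena.CardyFormulaZ2.Cruxes.LagHandOff.HittingTournament

namespace KernelContactIdentity

open KernelWalkToContact

variable {E : DiscreteDobrushin}

/-- An edge `{a, b}` that is open in the completed configuration `E.bcBondConfig ω` and starts
off the discrete arc of `A` is an `ω`-open edge of `Ω_δ` none of whose endpoints lies on the
discrete arc of `B` (the wiring alternative of `bcBondConfig` needs both endpoints on the arc
of `A`). -/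
theorem mem_of_adj_bcBondConfig {ω : BondConfig (Site 2)} {a b : Site 2}
    (h : (openGraph (E.bcBondConfig ω)).Adj a b) (haA : a ∉ E.zdArcA) :
    s(a, b) ∈ ω ∧ s(a, b) ∈ (discreteDomainGraph E.Ω E.δ).edgeSet ∧
      a ∉ E.zdArcB ∧ b ∉ E.zdArcB := by
  obtain ⟨⟨he, hA | ⟨hω, hB⟩⟩, -⟩ := (openGraph_adj _ a b).1 h
  · exact absurd (hA a (Sym2.mem_mk_left a b)) haA
  · exact ⟨hω, he, hB a (Sym2.mem_mk_left a b), hB b (Sym2.mem_mk_right a b)⟩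

/-- **(⇒)** Along an open walk of the completed configuration from a non-arc site `a ∈ Ω_δ`
to a site of the discrete arc of `A` there is a first contact: a non-arc site `u`, joined to
`a` inside `Ω_δ ∖ arcs` by `ω`-open `Ω_δ`-edges, and an `ω`-open `Ω_δ`-edge `{u, u'}` into the
arc of `A`.  Induction along the walk. -/
theorem contact_of_walk {ω : BondConfig (Site 2)} :
    ∀ {a z : Site 2} (_ : (openGraph (E.bcBondConfig ω)).Walk a z), z ∈ E.zdArcA →
      a ∈ meshDomain E.Ω E.δ → a ∉ E.zdArcA ∪ E.zdArcB →
      ∃ u u' : Site 2, u' ∈ E.zdArcA ∧ u ∉ E.zdArcA ∪ E.zdArcB ∧ s(u, u') ∈ ω ∧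
        s(u, u') ∈ (discreteDomainGraph E.Ω E.δ).edgeSet ∧
        (ω ∩ (discreteDomainGraph E.Ω E.δ).edgeSet) ∈
          openConnIn (meshDomain E.Ω E.δ \ (E.zdArcA ∪ E.zdArcB)) a u := by
  intro a z w
  induction w with
  | nil =>
    intro hz _ haA
    exact absurd (Or.inl hz) haA
  | @cons a b c h p ih =>
    intro hz ha haA
    obtain ⟨habω, habE, -, hbB⟩ := mem_of_adj_bcBondConfig h fun h' => haA (Or.inl h')
    have hab : (discreteDomainGraph E.Ω E.δ).Adj a b := (SimpleGraph.mem_edgeSet _).1 habE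
    have hb : b ∈ meshDomain E.Ω E.δ := (discreteDomainGraph_adj_iff.1 hab).2.2
    have haS : a ∈ meshDomain E.Ω E.δ \ (E.zdArcA ∪ E.zdArcB) := ⟨ha, haA⟩
    by_cases hbA : b ∈ E.zdArcA
    · -- first contact: the edge `{a, b}` itself
      exact ⟨a, b, hbA, haA, habω, habE, haS, haS, SimpleGraph.Reachable.refl _⟩
    · -- `b` is off both arcs: a contact further along, prepend the open `Ω_δ`-edge `{a, b}`
      have hbA' : b ∉ E.zdArcA ∪ E.zdArcB := fun h' => h'.elim hbA hbB
      obtain ⟨u, u', hu'A, huA, huu'ω, huu'E, hconn⟩ := ih hz hb hbA'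
      have hadj : (openGraph (ω ∩ (discreteDomainGraph E.Ω E.δ).edgeSet)).Adj a b :=
        (openGraph_adj _ a b).2 ⟨⟨habω, habE⟩, h.ne⟩
      exact ⟨u, u', hu'A, huA, huu'ω, huu'E,
        mem_openConnIn_of_adj_of_subset Subset.rfl haS hadj hconn⟩

/-- **(⇐)** A connection inside `Ω_δ ∖ arcs` by `ω`-open `Ω_δ`-edges from `x` to a non-arc
site `u`, followed by an `ω`-open contact edge `{u, u'}` of `Ω_δ` into the arc of `A`, is an
open path of the completed configuration from `x` to `u'` (for admissible data: `u' ∈ zdArcA`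
is off `zdArcB` by disjointness of the arcs, so the contact edge is not closed by the boundary
condition). -/
theorem reachable_of_contact (hE : E.IsZdAdmissible) {ω : BondConfig (Site 2)} {x u u' : Site 2}
    (hu'A : u' ∈ E.zdArcA) (huA : u ∉ E.zdArcA ∪ E.zdArcB) (huu'ω : s(u, u') ∈ ω)
    (huu'E : s(u, u') ∈ (discreteDomainGraph E.Ω E.δ).edgeSet)
    (hconn : (ω ∩ (discreteDomainGraph E.Ω E.δ).edgeSet) ∈
      openConnIn (meshDomain E.Ω E.δ \ (E.zdArcA ∪ E.zdArcB)) x u) :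
    (openGraph (E.bcBondConfig ω)).Reachable x u' := by
  obtain ⟨hx, hu, hr⟩ := hconn
  -- the inclusion of the open graph of `ω ∩ E(Ω_δ)` induced on the non-arc sites into the open
  -- graph of the completed configuration: an `ω`-open `Ω_δ`-edge between non-arc sites has no
  -- endpoint on the arc of `B`, so it is open in `E.bcBondConfig ω`
  let φ : (openGraph (ω ∩ (discreteDomainGraph E.Ω E.δ).edgeSet)).induce
        (meshDomain E.Ω E.δ \ (E.zdArcA ∪ E.zdArcB)) →g openGraph (E.bcBondConfig ω) :=
    { toFun := Subtype.val
      map_rel' := by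
        rintro ⟨a, ha⟩ ⟨b, hb⟩ hab
        rw [SimpleGraph.induce_adj] at hab
        obtain ⟨⟨habω, habE⟩, hne⟩ := (openGraph_adj _ a b).1 hab
        refine (openGraph_adj _ a b).2 ⟨⟨habE, Or.inr ⟨habω, ?_⟩⟩, hne⟩
        intro y hy
        rcases Sym2.mem_iff.1 hy with rfl | rfl
        · exact fun h' => ha.2 (Or.inr h')
        · exact fun h' => hb.2 (Or.inr h') }
  have hxu : (openGraph (E.bcBondConfig ω)).Reachable x u := hr.map φ
  -- the contact edge `{u, u'}` is open in the completed configuration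
  refine hxu.trans (SimpleGraph.Adj.reachable
    ((openGraph_adj _ u u').2 ⟨⟨huu'E, Or.inr ⟨huu'ω, ?_⟩⟩, ?_⟩))
  · intro y hy
    rcases Sym2.mem_iff.1 hy with rfl | rfl
    · exact fun h' => huA (Or.inr h')
    · exact fun h' => Set.disjoint_left.1 hE.disjoint hu'A h'
  · rintro rfl
    exact huA (Or.inl hu'A)

end KernelContactIdentity

open KernelContactIdentity in
/-- **K5 `stub_kernel_contactIdentity`.** The open cluster of the wired arc, off the arcs, is
exactly the set of sites joined inside `Ω_δ ∖ (arcs)` by `ω`-open edges of `Ω_δ` to a non-arc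
site carrying an `ω`-OPEN contact edge of `Ω_δ` into the discrete arc of `A` (for admissible
data: arc-`B` sites carry only closed edges in `E.bcBondConfig ω`, arc-`A` edges are all open).
(⇒) first contact along an open walk of the completed configuration (`contact_of_walk`);
(⇐) the induced open graph on non-arc sites maps into the open graph of the completed
configuration, and the contact edge is open there (`reachable_of_contact`). -/
theorem stub_kernel_contactIdentity :
    ∀ (E : DiscreteDobrushin), E.IsZdAdmissible → ∀ (ω : BondConfig (Site 2)) (x : Site 2),
      x ∈ meshDomain E.Ω E.δ → x ∉ E.zdArcA ∪ E.zdArcB →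
      ((∃ z ∈ E.zdArcA, E.bcBondConfig ω ∈ openConn x z) ↔
        ∃ u u' : Site 2, u' ∈ E.zdArcA ∧ u ∉ E.zdArcA ∪ E.zdArcB ∧ s(u, u') ∈ ω ∧
          s(u, u') ∈ (discreteDomainGraph E.Ω E.δ).edgeSet ∧
          (ω ∩ (discreteDomainGraph E.Ω E.δ).edgeSet) ∈
            openConnIn (meshDomain E.Ω E.δ \ (E.zdArcA ∪ E.zdArcB)) x u) := by
  intro E hE ω x hx hxA
  constructor
  · rintro ⟨z, hz, ⟨w⟩⟩
    exact contact_of_walk w hz hx hxA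
  · rintro ⟨u, u', hu'A, huA, huu'ω, huu'E, hconn⟩
    exact ⟨u', hu'A, reachable_of_contact hE hu'A huA huu'ω huu'E hconn⟩

end Summit.CriticalPhenomena.CardyFormulaZ2.Cruxes.LagHandOff.HittingTournament

end
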